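import Mathlib
import HarnessLib
import Summits.ValiantsHypothesis.ValiantsHypothesis.Theorems.MonotoneRestorationOrbitRestorationQPSimpleGraphCut
import Summits.ValiantsHypothesis.ValiantsHypothesis.Theorems.MonotoneRestorationMonotoneRestorationQPLinearWidthOrbitSeparation
import Summits.ValiantsHypothesis.ValiantsHypothesis.Theorems.MonotoneRestorationMonotoneRestorationQPCruxImpliesFooling

/-!
# Route MonotoneRestoration, crux `OrbitRestorationQP` (stmt-18293) — the simple-graph half H₁ is
# THRESHOLD-FREE, and the cut in KILL-WITNESS form

Helper file (`--supports`), def-free; continues `…OrbitRestorationQPSimpleGraphCut.lean` (p825758).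

* `ckDetermined_iff_thresholdFree` — for a MATRIX-SYMMETRIC family the finite-model-theory half
  H₁ ("eventually, beyond some order `N`, `C^{(log₂ m + c)^c}`-determined on simple graphs") is equivalent to its
  threshold-free form (`N = 0`, one larger exponent): below the threshold the exponent is raised until
  `(log₂ m + c')^{c'} ≥ 4·(m!)²`, where `C^k`-equivalence forces hom-indistinguishability of the adjacency matrices
  for ALL bipartite patterns that matter (`homIndist_indicator_of_ckEquiv`, Dvořák) and hence equal values of any
  matrix-symmetric polynomial (`OrbitSeparation.eval_eq_of_homIndist_of_matrixSymmetric`, Lovász over `ℂ`);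
* `simpleGraphHalf_iff_not_polylogWidthVP` — "H₁ for every matrix-symmetric `VP` family" is LITERALLY
  `¬ PolylogWidthVP` (the refuter's missing construction of `…/Negative/OrbitRestorationFalseOfPolylogWidthVP.lean`);
* `orbitRestorationQP_iff_cut_witness` — hence `OrbitRestorationQP ⟺ W₁ ∧ ¬ PolylogWidthVP`: the crux L1 is EXACTLY
  its circuit half W₁ plus the non-existence of a polylog-width `VP` family (the size-currency twin for
  stmt-15886 / stmt-16191 is `monotoneRestorationQP_iff_cut_witness`, p825855).

Honest label: by-name glue; no stub closed; L1 and VP ≠ VNP NOT moved.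
[cite: Dvorak2010, Thm 6; Lovasz1967, Thm (hom counts determine isomorphism); DawarWilsenach2025, §6, §8]
-/

-- `Summit.ValiantsHypothesis.ValiantsHypothesis.…` is the tree's mandated namespace (Sub = Summit).
set_option linter.dupNamespace false

noncomputable section

namespace Summit.ValiantsHypothesis.ValiantsHypothesis.Theorems

namespace SimpleGraphCut

open Summit.ValiantsHypothesis.ValiantsHypothesis.Theses.MonotoneRestoration
open Literature.Computability.AlgebraicComplexity
open Literature.ModelTheory.FiniteModelTheory
open MonotoneRestorationQPLinearWidth
open MvPolynomial

/-- Below any fixed order the level can be made to exceed `4·(m!)²` by raising the exponent. [folklore] -/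
theorem four_mul_factorial_sq_le_logPow {m N c : ℕ} (hm : m ≤ N) (L : ℕ) :
    4 * (Nat.factorial m) ^ 2 ≤ (L + (c + 4 * (Nat.factorial N) ^ 2 + 1)) ^ (c + 4 * (Nat.factorial N) ^ 2 + 1) := by
  have hfac : Nat.factorial m ≤ Nat.factorial N := Nat.factorial_le hm
  have h1 : 4 * (Nat.factorial m) ^ 2 ≤ 4 * (Nat.factorial N) ^ 2 :=
    Nat.mul_le_mul_left 4 (Nat.pow_le_pow_left hfac 2)
  have h2 : c + 4 * (Nat.factorial N) ^ 2 + 1 ≤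
      (L + (c + 4 * (Nat.factorial N) ^ 2 + 1)) ^ (c + 4 * (Nat.factorial N) ^ 2 + 1) :=
    calc c + 4 * (Nat.factorial N) ^ 2 + 1
        ≤ (c + 4 * (Nat.factorial N) ^ 2 + 1) ^ (c + 4 * (Nat.factorial N) ^ 2 + 1) :=
          Nat.le_self_pow (by omega) _
      _ ≤ (L + (c + 4 * (Nat.factorial N) ^ 2 + 1)) ^ (c + 4 * (Nat.factorial N) ^ 2 + 1) :=
          Nat.pow_le_pow_left (by omega) _
  omega

/-- **At a huge level, `C^k`-equivalence forces equal values of every matrix-symmetric polynomial.**  If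
`X ≡^{C^k} Y` on `Fin m` with `k ≥ 4·(m!)²`, then every matrix-symmetric `F` takes the same value at the two adjacency
matrices (Dvořák bridge + Lovász over `ℂ`, `OrbitSeparation.eval_eq_of_homIndist_of_matrixSymmetric`).
[cite: Dvorak2010, Thm 6] -/
theorem eval_indicator_eq_of_ckEquiv_of_le {m k : ℕ} (F : MvPolynomial (Fin m × Fin m) ℂ)
    (hF : ∀ σ τ : Equiv.Perm (Fin m), rename (fun ij : Fin m × Fin m => (σ ij.1, τ ij.2)) F = F)
    (hk : 4 * (Nat.factorial m) ^ 2 ≤ k) {X Y : SimpleGraph (Fin m)} (h : CkEquiv k X Y) :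
    MvPolynomial.eval (Set.indicator {ij : Fin m × Fin m | X.Adj ij.1 ij.2} 1) F =
      MvPolynomial.eval (Set.indicator {ij : Fin m × Fin m | Y.Adj ij.1 ij.2} 1) F :=
  OrbitSeparation.eval_eq_of_homIndist_of_matrixSymmetric F hF hk _ _
    fun a b E htw => homIndist_indicator_of_ckEquiv h a b E htw

/-- **H₁ is threshold-free for matrix-symmetric families.**  "Eventually (beyond some order `N`)
`C^{(log₂ m + c)^c}`-determined on simple graphs" ⟺ "at EVERY order `C^{(log₂ m + c')^{c'}}`-determined", for a
matrix-symmetric family: take `c' = c + 4·(N!)² + 1`; above `N` use monotonicity of `CkEquiv` in the level, below `N`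
the previous lemma. [folklore] -/
theorem ckDetermined_iff_thresholdFree (f : (n : ℕ) → MvPolynomial (Fin n × Fin n) ℂ) (hs : IsMatrixSymmetric f) :
    (∃ c N : ℕ, ∀ m : ℕ, N ≤ m → ∀ X Y : SimpleGraph (Fin m), CkEquiv ((Nat.log 2 m + c) ^ c) X Y →
        MvPolynomial.eval (Set.indicator {ij : Fin m × Fin m | X.Adj ij.1 ij.2} 1) (f m) =
          MvPolynomial.eval (Set.indicator {ij : Fin m × Fin m | Y.Adj ij.1 ij.2} 1) (f m)) ↔
      ∃ c : ℕ, ∀ (m : ℕ) (X Y : SimpleGraph (Fin m)), CkEquiv ((Nat.log 2 m + c) ^ c) X Y →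
        MvPolynomial.eval (Set.indicator {ij : Fin m × Fin m | X.Adj ij.1 ij.2} 1) (f m) =
          MvPolynomial.eval (Set.indicator {ij : Fin m × Fin m | Y.Adj ij.1 ij.2} 1) (f m) := by
  constructor
  · rintro ⟨c, N, h⟩
    refine ⟨c + 4 * (Nat.factorial N) ^ 2 + 1, fun m X Y hXY => ?_⟩
    rcases le_or_gt N m with hNm | hmN
    · exact h m hNm X Y (hXY.mono (cruxImpliesFooling_pow_le _ (by omega) (by omega)))
    · exact eval_indicator_eq_of_ckEquiv_of_le (f m) (hs m)
        (four_mul_factorial_sq_le_logPow hmN.le _) hXY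
  · rintro ⟨c, h⟩
    exact ⟨c, 0, fun m _ X Y hXY => h m X Y hXY⟩

/-- **"H₁ for every matrix-symmetric `VP` family" is literally `¬ PolylogWidthVP`.** [folklore] -/
theorem simpleGraphHalf_iff_not_polylogWidthVP :
    (∀ f : (n : ℕ) → MvPolynomial (Fin n × Fin n) ℂ, IsMatrixSymmetric f → IsVPFamily f →
      ∃ c N : ℕ, ∀ m : ℕ, N ≤ m → ∀ X Y : SimpleGraph (Fin m), CkEquiv ((Nat.log 2 m + c) ^ c) X Y →
        MvPolynomial.eval (Set.indicator {ij : Fin m × Fin m | X.Adj ij.1 ij.2} 1) (f m) =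
          MvPolynomial.eval (Set.indicator {ij : Fin m × Fin m | Y.Adj ij.1 ij.2} 1) (f m)) ↔
      ¬ PolylogWidthVP := by
  unfold PolylogWidthVP IsMatrixSymmetric
  push Not
  constructor
  · intro h f hs hVP
    exact h f hs hVP
  · intro h f hs hVP
    exact h f hs hVP

/-- **`OrbitRestorationQP ⟺ W₁ ∧ ¬ PolylogWidthVP`.**  The crux L1 is exactly its circuit half plus the non-existence
of a polylog-width matrix-symmetric `VP` family (`orbitRestorationQP_iff_simpleGraphCut` + the previous lemma).
[folklore] -/
theorem orbitRestorationQP_iff_cut_witness :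
    OrbitRestorationQP ↔
      ((∀ f : (n : ℕ) → MvPolynomial (Fin n × Fin n) ℂ, IsMatrixSymmetric f → IsVPFamily f →
          (∃ c N : ℕ, ∀ m : ℕ, N ≤ m → ∀ X Y : SimpleGraph (Fin m),
            CkEquiv ((Nat.log 2 m + c) ^ c) X Y →
              MvPolynomial.eval (Set.indicator {ij : Fin m × Fin m | X.Adj ij.1 ij.2} 1) (f m) =
                MvPolynomial.eval (Set.indicator {ij : Fin m × Fin m | Y.Adj ij.1 ij.2} 1) (f m)) →
          QPOrbitSymm f) ∧
        ¬ PolylogWidthVP) := by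
  rw [← simpleGraphHalf_iff_not_polylogWidthVP]
  exact orbitRestorationQP_iff_simpleGraphCut

/-- **W₁ with the threshold-free hypothesis suffices.**  Since H₁ is threshold-free for matrix-symmetric families,
the circuit half may assume determination at EVERY order: this form of W₁ together with `¬ PolylogWidthVP` gives L1.
[folklore] -/
theorem orbitRestorationQP_of_thresholdFreeW_of_not_polylogWidthVP
    (hW : ∀ f : (n : ℕ) → MvPolynomial (Fin n × Fin n) ℂ, IsMatrixSymmetric f → IsVPFamily f →
      (∃ c : ℕ, ∀ (m : ℕ) (X Y : SimpleGraph (Fin m)), CkEquiv ((Nat.log 2 m + c) ^ c) X Y →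
        MvPolynomial.eval (Set.indicator {ij : Fin m × Fin m | X.Adj ij.1 ij.2} 1) (f m) =
          MvPolynomial.eval (Set.indicator {ij : Fin m × Fin m | Y.Adj ij.1 ij.2} 1) (f m)) →
      QPOrbitSymm f)
    (hH : ¬ PolylogWidthVP) : OrbitRestorationQP := by
  refine orbitRestorationQP_iff_cut_witness.mpr ⟨fun f hs hVP hdet => ?_, hH⟩
  exact hW f hs hVP ((ckDetermined_iff_thresholdFree f hs).mp hdet)

end SimpleGraphCut

end Summit.ValiantsHypothesis.ValiantsHypothesis.Theorems

end
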